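import Mathlib
import Literature.RepresentationTheory.FiniteGroups.KLRGradedCellularBasis

/-!
# Definitions: one step of Plancherel growth against the parity charges (route `SnSubsetDichotomy`, crux `NoThresholdSubsetTriple`)

Objects posited by the klr line's Freedman architecture for J′ (lead c7 report
`Cruxes/NoThresholdSubsetTriple/Lines/klr_graded_polynomial_method-lead-c7.md` §2a, app. A; statements first recorded in the crux
workfile `Lines/klr_dev_rungs.lean`).  Everything is stated for a finite cell set `ν ⊆ ℕ × ℕ` (a Young diagram when `ν` is a lower
set) because the growth process INSERTS cells (`insert z ν`), which the bundled `YoungDiagram`/`Nat.Partition` types do not support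
directly; `Literature.RepresentationTheory.FiniteGroups.addableNodes` (also `Finset`-level) supplies the corners.

* `PlancherelStep.rowLen / colLen / hook` — row and column lengths and hook lengths of a cell set;
* `PlancherelStep.transProb ν y` — the Plancherel transition probability of the addable node `y`, in HOOK-PRODUCT form
  `∏_{j < col y} h(row y, j)/(h+1) · ∏_{i < row y} h(i, col y)/(h+1)` (`= f^{ν∪y}/((|ν|+1)·f^ν)` by the hook length formula);
* `PlancherelStep.rowCharge / colCharge / chargeBelow / chargeRight / incr` — the parity charges `χ_i = (−1)^i[row i odd]`, their tails
  `R(r) = Σ_{i>r} χ_i`, `C(c) = Σ_{j>c} χ^c_j`, and the J-increment `x_y = R(row y) − C(col y)` seen from a corner `y`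
  (tree: `stub_pairDiff_eq_chargeSum` is `J(T) = Σ_k π_k · x_{y_k}`);
* `PlancherelStep.sqEnergy ν = Σ_{y addable} p_y · x_y²` — the conditional second moment of the J-increment (the `q` of (Q)).
-/

noncomputable section

open scoped BigOperators

namespace Summit.MatrixMultiplication.MatrixMultiplication.Theorems

-- `Summit.<Summit>.<Problem>`: the two coincide for this single-conjunct summit.
set_option linter.dupNamespace false

namespace PlancherelStep

open Literature.RepresentationTheory.FiniteGroups (addableNodes)

/-- Row length of row `i` of the cell set `ν` (number of cells `(i, j) ∈ ν`). [folklore] -/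
def rowLen (ν : Finset (ℕ × ℕ)) (i : ℕ) : ℕ := (ν.filter fun c => c.1 = i).card

/-- Column length of column `j` of the cell set `ν`. [folklore] -/
def colLen (ν : Finset (ℕ × ℕ)) (j : ℕ) : ℕ := (ν.filter fun c => c.2 = j).card

/-- Hook length of the cell `(i, j)` in the cell set `ν`: arm + leg + 1 (a junk value off a Young diagram).
[cite: FrameRobinsonThrallCJM1954, §2] -/
def hook (ν : Finset (ℕ × ℕ)) (c : ℕ × ℕ) : ℕ := (rowLen ν c.1 - c.2) + (colLen ν c.2 - c.1) - 1

/-- Plancherel transition probability of the addable node `y = (r, c)` of `ν`, hook-product form: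
`p_y = ∏_{j < c} h(r,j)/(h(r,j)+1) · ∏_{i < r} h(i,c)/(h(i,c)+1)`; equals `f^{ν ∪ y}/((|ν|+1) f^ν)` by the hook length formula
(Greene–Nijenhuis–Wilf hook walk). [folklore] -/
def transProb (ν : Finset (ℕ × ℕ)) (y : ℕ × ℕ) : ℝ :=
  (∏ j ∈ Finset.range y.2, ((hook ν (y.1, j) : ℝ) / (hook ν (y.1, j) + 1))) *
    ∏ i ∈ Finset.range y.1, ((hook ν (i, y.2) : ℝ) / (hook ν (i, y.2) + 1))

/-- Row-parity charge `χ_i = (−1)^i · [row i has odd length]`. [folklore] -/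
def rowCharge (ν : Finset (ℕ × ℕ)) (i : ℕ) : ℤ := if Odd (rowLen ν i) then (-1) ^ i else 0

/-- Column-parity charge `χ^c_j = (−1)^j · [column j has odd length]`. [folklore] -/
def colCharge (ν : Finset (ℕ × ℕ)) (j : ℕ) : ℤ := if Odd (colLen ν j) then (-1) ^ j else 0

/-- Charge strictly below row `r`: `R(r) = Σ_{i > r} χ_i` (rows of index `> |ν|` are empty, so the finite range suffices). [folklore] -/
def chargeBelow (ν : Finset (ℕ × ℕ)) (r : ℕ) : ℤ :=
  ∑ i ∈ (Finset.range (ν.card + 1)).filter (fun i => r < i), rowCharge ν i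

/-- Charge strictly right of column `c`: `C(c) = Σ_{j > c} χ^c_j`. [folklore] -/
def chargeRight (ν : Finset (ℕ × ℕ)) (c : ℕ) : ℤ :=
  ∑ j ∈ (Finset.range (ν.card + 1)).filter (fun j => c < j), colCharge ν j

/-- The J-increment seen from the node `y`: `x_y = R(row y) − C(col y)`. [folklore] -/
def incr (ν : Finset (ℕ × ℕ)) (y : ℕ × ℕ) : ℤ := chargeBelow ν y.1 - chargeRight ν y.2

/-- Conditional second moment of the J-increment under one Plancherel step: `q(ν) = Σ_{y addable} p_y · x_y²`. [folklore] -/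
def sqEnergy (ν : Finset (ℕ × ℕ)) : ℝ := ∑ y ∈ addableNodes ν, transProb ν y * ((incr ν y : ℝ) ^ 2)

/-- Each hook factor `h/(h+1)` is nonnegative, so transition probabilities are nonnegative. [folklore] -/
theorem transProb_nonneg (ν : Finset (ℕ × ℕ)) (y : ℕ × ℕ) : 0 ≤ transProb ν y := by
  unfold transProb
  refine mul_nonneg (Finset.prod_nonneg fun j _ => ?_) (Finset.prod_nonneg fun i _ => ?_) <;> positivity

end PlancherelStep

/-- The conditional second moment `q(ν)` is nonnegative. [folklore] -/
theorem sqEnergy_nonneg : ∀ ν : Finset (ℕ × ℕ), 0 ≤ PlancherelStep.sqEnergy ν := by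
  intro ν
  unfold PlancherelStep.sqEnergy
  exact Finset.sum_nonneg fun y _ => mul_nonneg (PlancherelStep.transProb_nonneg ν y) (sq_nonneg _)

end Summit.MatrixMultiplication.MatrixMultiplication.Theorems

end
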